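/-
Copyright: the b2b-balaban T⁴-continuum CRUX team, row NE7b leaf lineage `t4-ne7b-formalise-leaf-03` (gen 147). Project licence.
-/
import Mathlib.Analysis.Calculus.InverseFunctionTheorem.ContDiff
import Mathlib.Analysis.Calculus.ContDiff.RCLike
import Mathlib.Analysis.Calculus.Deriv.Slope
import Mathlib.Analysis.Calculus.Deriv.Comp
import Mathlib.Analysis.Calculus.Deriv.Add
import Mathlib.Analysis.Calculus.Deriv.Mul
import Mathlib.Analysis.Convex.Function
import Mathlib.Analysis.Calculus.LocalExtr.Basic
import Mathlib.Analysis.Normed.Operator.Bilinear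
import Mathlib.Analysis.Normed.Module.FiniteDimension
import Mathlib.Analysis.Normed.Operator.Banach
import Mathlib.LinearAlgebra.Dual.Lemmas
import Mathlib.Order.ConditionallyCompleteLattice.Indexed

/-!
# THE HARD STEP PRESERVES SMOOTHNESS: the constrained critical points of a `C^{n+1}` action over the fibres of a linear onto
# map form a `Cⁿ` BRANCH through every non-degenerate one (inverse function theorem on the augmented map
# `δ ↦ (Dδ, DV(δ)|_{ker D})`), the branch IS the fibre-minimiser map when the action is convex, and the hard-constraint
# value function `φ w = min {V δ : D δ = w}` is `C^{n+1}` near `w₀` with `Dφ(w) = DV(δ(w)) ∘ M` for ANY right inverse `M`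
# (row NE7b, node U5c; TRANSFER row (xxiv) (L1)'s REGULARITY clause — «the fibre-minimiser map is C¹, `constrValue` is C²»,
# the «implicit-function territory» this lineage's CVD ∕ CSTF ∕ CVS ∕ CVH all left NOT HERE; [folklore] sensitivity analysis)

Cell `pub-balaban`, sub-cell `t4`, spine estimate NE7b (`T4WeightBudget.RelWeightBound`; NOT PRINTED in [Bałaban 1983–89],
NOT PROVED).  Crux-route work under `Spine/NE7b/` by leaf-03 (CRUX team (2), FREEZE (0) crux-prover clause).  NOTHING of
Bałaban's is named as object, asserted, valued or discharged.  Mathlib only; no `def`; zero `sorry`.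

WHY.  The convexity road iterates «next action = hard-constraint value of the current action» (`φ w = ⨅_{D δ = w} V δ`,
the `a = ∞` end of the soft step).  Its letters were typed in Peano ∕ first-order currency by this lineage
(`ConstrainedValueDeriv` p377468: `Dφ(w) = DV(δ₀) ∘ M` AT a minimiser; `ConstrainedValueSecondOrder` p378453 and
`ConstrainedValueHessian`: the second-order EXPANSION at `w₀`), each time with the honest rider that the REGULARITY statement
— the minimiser depends smoothly on the constraint value and `φ` inherits one more derivative than the expansion shows — is
«implicit-function territory, NOT HERE» (idea-1 T-85 §4 (L1): *"the fibre-minimiser map `w ↦ δ(w)` is C¹ on U …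
`constrValue` is C² at w₀"*).  Without it the induction cannot be run in Hessian currency (the next action must again be
`C²` for `HessianLocality`-type letters).  This file types it, for every order `n ≥ 1`.

WHAT IS PROVED ([folklore]: Fiacco, *Introduction to Sensitivity and Stability Analysis in Nonlinear Programming* (1983)
Thm 2.1 ∕ §3.2; Bonnans–Shapiro, *Perturbation Analysis of Optimization Problems* (2000) §4.7; the device — inverse function
theorem for the map `(constraint, reduced gradient)` — is Lusternik's).  `E`, `F` finite-dimensional real normed spaces,
`D : E →L[ℝ] F` ONTO, `V : E → ℝ`.
* §1 `exists_contDiffAt_criticalBranch` — THE BRANCH: `V` of class `C^{n+1}` at `δ₀` (`1 ≤ n`), `δ₀` fibre-critical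
  (`DV(δ₀)` kills `ker D`) and NON-DEGENERATE (`D²V(δ₀)` restricted to `ker D × ker D` non-degenerate — e.g. positive) ⟹
  there is `σ : F → E`, `Cⁿ` at `w₀ = Dδ₀`, with `σ w₀ = δ₀`, EVENTUALLY in `w`: `D(σ w) = w` and `σ w` fibre-critical, and
  EVENTUALLY in `δ`: every fibre-critical `δ` near `δ₀` lies on the branch (`σ (D δ) = δ`) — local uniqueness.  Device: the
  augmented map `Φ δ = (Dδ, DV(δ) ∘ ι)` (`ι : ker D → E`) is `Cⁿ` with derivative `(D, D²V(δ₀)(·) ∘ ι)`, injective by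
  non-degeneracy, onto by `dim E = dim F + dim ker D = dim (F × (ker D)^*)`; Mathlib's `ContDiffAt.to_localInverse`.
  `exists_contDiffAt_criticalBranch_of_pos` — the positive-definite-on-`ker D` case.
* §2 `convex_support_of_hasFDerivAt` (the differential of a convex function supports it — re-derived for a NORMED `E`, the
  tree's `Literature.Analysis.Convex.Subgradient.ConvexOn.apply_add_fderiv_le` being stated over an inner-product space),
  `isMinOn_fibre_of_critical` — for CONVEX `V` a fibre-critical point minimises `V` on its fibre; `eq_of_isMinOn_fibre` —
  for STRICTLY convex `V` the fibre minimiser is unique; hence `criticalBranch_isMinOn`: the branch IS the minimiser map.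
* §3 `hasFDerivAt_comp_branch` — along ANY map `σ` with `D ∘ σ = id` near `w` and `σ w` fibre-critical:
  `D(V ∘ σ)(w) = DV(σ w) ∘ M` for ANY right inverse `M` of `D` (the `Dσ(w) − M` directions are in `ker D`, killed by
  criticality — the envelope formula OFF the base point); `iInf_fibre_eq_of_isMinOn` (`φ w = V(σ w)` where the branch
  minimises); **`contDiffAt_constrValue`** — THE END: `V` convex and `C^{n+1}` at a non-degenerate fibre minimiser `δ₀` over
  `w₀` ⟹ `φ = (w ↦ ⨅ δ : {δ // D δ = w}, V δ)` is `C^{n+1}` at `w₀` (one order MORE than the branch: `Dφ = (DV ∘ σ) ∘ M` is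
  `Cⁿ`), with `hasFDerivAt_constrValue_branch`: `HasFDerivAt φ (DV(σ w) ∘ M) w` for `w` near `w₀`.
* §4 toy (`example`): `E = F = ℝ`, `D = id` — the fibre is a point, `φ = V`, and the theorem returns `V`'s own class.

NOT HERE (honest): the Hessian IDENTITY `D²φ(w₀) = q_D` (this lineage's `ConstrainedValueHessian`, retry lane, gives it from
the Peano expansion once `φ` is known `C²` — the two files meet by name, no import either way); windows (`V` convex on a
convex `K ∈ 𝓝 δ₀` only: the branch §1 is local anyway, §2 needs convexity on the fibre through the window — CVW's currency;
not typed here); NONLINEAR constraints (CVL ∕ CVSec's section; the same augmented-map device works with `DG(δ)` in place of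
`D` — not typed here); infinite dimension (the finrank count is used); which `V, D` are Bałaban's ((A3) ∕ (A1c), NC-NE7b-α
UNRULED).  BY-NAME EFFECT ON THE WALL: NONE.  NE7b NOT PRINTED ∕ NOT PROVED; spine PROVED 0∕9; rung (B)+1 on a FINITE
torus — NOT infinite volume, NOT the mass gap, NOT Clay.  HONEST DEPENDENCY: continuum YM on T⁴ ⇐ BetaPertH ∧ nine spine
estimates (0/9 proved); BetaPertH ⇐ (D1) ∧ (D4) ∧ CAP+tail; G-an2-4 gates asym, D1 and NE2∕3∕4.
-/

set_option autoImplicit false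

noncomputable section

namespace Summit.QuantumFields.BalabanUV.T4Continuum.NE7b.ConstrainedMinimiserRegular

open Set Filter Topology Function

variable {E F : Type*} [NormedAddCommGroup E] [NormedSpace ℝ E] [NormedAddCommGroup F] [NormedSpace ℝ F]

/-! ## §1. The branch of constrained critical points (inverse function theorem on the augmented map) -/

section Branch

variable [FiniteDimensional ℝ E] [FiniteDimensional ℝ F]

/-- Dimension count: for `D` onto, `dim E = dim (F × (ker D →L ℝ))` (rank–nullity + `dim (ker D)^* = dim ker D`). [folklore] -/
theorem finrank_eq_finrank_prod_dual (D : E →L[ℝ] F) (hD : Surjective D) :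
    Module.finrank ℝ E = Module.finrank ℝ (F × (D.ker →L[ℝ] ℝ)) := by
  have hdual : Module.finrank ℝ (D.ker →L[ℝ] ℝ) = Module.finrank ℝ D.ker := by
    rw [← LinearEquiv.finrank_eq (LinearMap.toContinuousLinearMap :
      (D.ker →ₗ[ℝ] ℝ) ≃ₗ[ℝ] (D.ker →L[ℝ] ℝ))]
    exact Subspace.dual_finrank_eq
  have hrn := LinearMap.finrank_range_add_finrank_ker (D : E →ₗ[ℝ] F)
  rw [LinearMap.range_eq_top.mpr hD, finrank_top] at hrn
  rw [Module.finrank_prod, hdual, ← hrn]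

omit [FiniteDimensional ℝ E] [FiniteDimensional ℝ F] in
/-- The derivative of the augmented map, `h ↦ (D h, D²V(δ₀)(h) ∘ ι)`, is injective when `D²V(δ₀)` is non-degenerate on
`ker D`. [folklore] -/
theorem ker_augmented_eq_bot (D : E →L[ℝ] F) (B : E →L[ℝ] E →L[ℝ] ℝ)
    (hnd : ∀ k ∈ D.ker, (∀ k' ∈ D.ker, B k k' = 0) → k = 0) :
    (D.prod (((ContinuousLinearMap.compL ℝ D.ker E ℝ).flip D.ker.subtypeL).comp B)).ker = ⊥ := by
  rw [LinearMap.ker_eq_bot']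
  intro h hh
  have h1 : D h = 0 := congrArg Prod.fst hh
  have h2 : ((ContinuousLinearMap.compL ℝ D.ker E ℝ).flip D.ker.subtypeL) (B h) = 0 := congrArg Prod.snd hh
  refine hnd h h1 fun k' hk' => ?_
  have h3 := congrArg (fun L : D.ker →L[ℝ] ℝ => L ⟨k', hk'⟩) h2
  simpa using h3

/-- **THE `Cⁿ` BRANCH OF CONSTRAINED CRITICAL POINTS.**  `E`, `F` finite-dimensional, `D : E →L[ℝ] F` onto, `V` of class
`C^{n+1}` at `δ₀` (`1 ≤ n`), `δ₀` fibre-critical (`DV(δ₀) k = 0` for `k ∈ ker D`) and non-degenerate (`D²V(δ₀)` — Mathlib's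
`fderiv ℝ (fderiv ℝ V) δ₀` — non-degenerate on `ker D`).  Then there is `σ : F → E` with `σ (D δ₀) = δ₀`, `Cⁿ` at `D δ₀`,
such that EVENTUALLY as `w → D δ₀`: `D (σ w) = w` and `σ w` is fibre-critical; and EVENTUALLY as `δ → δ₀`: if `δ` is
fibre-critical then `δ = σ (D δ)` (local uniqueness of the branch). [folklore] -/
theorem exists_contDiffAt_criticalBranch {V : E → ℝ} {D : E →L[ℝ] F} (hD : Surjective D) {δ₀ : E} {n : ℕ}
    (hn : 1 ≤ n) (hV : ContDiffAt ℝ (n + 1) V δ₀) (hcrit : ∀ k ∈ D.ker, fderiv ℝ V δ₀ k = 0)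
    (hnd : ∀ k ∈ D.ker, (∀ k' ∈ D.ker, fderiv ℝ (fderiv ℝ V) δ₀ k k' = 0) → k = 0) :
    ∃ σ : F → E, σ (D δ₀) = δ₀ ∧ ContDiffAt ℝ n σ (D δ₀) ∧
      (∀ᶠ w in 𝓝 (D δ₀), D (σ w) = w ∧ ∀ k ∈ D.ker, fderiv ℝ V (σ w) k = 0) ∧
      (∀ᶠ δ in 𝓝 δ₀, (∀ k ∈ D.ker, fderiv ℝ V δ k = 0) → σ (D δ) = δ) := by
  haveI : CompleteSpace E := FiniteDimensional.complete ℝ E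
  haveI : CompleteSpace (F × (D.ker →L[ℝ] ℝ)) := FiniteDimensional.complete ℝ _
  -- the augmented map and its derivative
  set K := D.ker with hK
  set R := (ContinuousLinearMap.compL ℝ K E ℝ).flip K.subtypeL with hR
  set Φ : E → F × (K →L[ℝ] ℝ) := fun δ => (D δ, R (fderiv ℝ V δ)) with hΦ
  set Φ' := D.prod (R.comp (fderiv ℝ (fderiv ℝ V) δ₀)) with hΦ'
  have hR0 : ∀ δ : E, (∀ k ∈ K, fderiv ℝ V δ k = 0) → R (fderiv ℝ V δ) = 0 := fun δ hδ => by
    ext ⟨k, hk⟩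
    simpa [hR] using hδ k hk
  have hR0' : ∀ δ : E, R (fderiv ℝ V δ) = 0 → ∀ k ∈ K, fderiv ℝ V δ k = 0 := fun δ hδ k hk => by
    have h3 := congrArg (fun L : K →L[ℝ] ℝ => L ⟨k, hk⟩) hδ
    simpa [hR] using h3
  have hΦδ₀ : Φ δ₀ = (D δ₀, 0) := by
    simp only [hΦ, hR0 δ₀ hcrit]
  -- smoothness of Φ
  have hdV : ContDiffAt ℝ n (fderiv ℝ V) δ₀ := hV.fderiv_right (by norm_cast)
  have hn0 : (n : WithTop ℕ∞) ≠ 0 := by exact_mod_cast (Nat.one_le_iff_ne_zero.mp hn)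
  have hΦcd : ContDiffAt ℝ n Φ δ₀ :=
    D.contDiff.contDiffAt.prodMk (R.contDiff.contDiffAt.comp δ₀ hdV)
  have hΦd : HasFDerivAt Φ Φ' δ₀ :=
    D.hasFDerivAt.prodMk (R.hasFDerivAt.comp δ₀ (hdV.differentiableAt hn0).hasFDerivAt)
  -- the derivative is an isomorphism
  have hinj : Φ'.ker = ⊥ := ker_augmented_eq_bot D (fderiv ℝ (fderiv ℝ V) δ₀) hnd
  have hsurj : Φ'.range = ⊤ :=
    LinearMap.range_eq_top.mpr
      ((LinearMap.injective_iff_surjective_of_finrank_eq_finrank (finrank_eq_finrank_prod_dual D hD)).mp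
        (LinearMap.ker_eq_bot.mp hinj))
  set Φe : E ≃L[ℝ] F × (K →L[ℝ] ℝ) := ContinuousLinearEquiv.ofBijective Φ' hinj hsurj with hΦe
  have hΦe' : HasFDerivAt Φ (Φe : E →L[ℝ] F × (K →L[ℝ] ℝ)) δ₀ := by
    rw [hΦe, ContinuousLinearEquiv.coe_ofBijective]; exact hΦd
  -- inverse function theorem
  have hstrict := hΦcd.hasStrictFDerivAt' hΦe' hn0
  set Ψ : F × (K →L[ℝ] ℝ) → E := hΦcd.localInverse hΦe' hn0 with hΨ
  have hΨcd : ContDiffAt ℝ n Ψ (Φ δ₀) := hΦcd.to_localInverse hΦe' hn0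
  have hΨ0 : Ψ (Φ δ₀) = δ₀ := hΦcd.localInverse_apply_image hΦe' hn0
  have hleft : ∀ᶠ δ in 𝓝 δ₀, Ψ (Φ δ) = δ := hstrict.eventually_left_inverse
  have hright : ∀ᶠ y in 𝓝 (Φ δ₀), Φ (Ψ y) = y := hstrict.eventually_right_inverse
  -- the branch: σ w = Ψ (w, 0)
  have hj : Continuous fun w : F => ((w, (0 : K →L[ℝ] ℝ)) : F × (K →L[ℝ] ℝ)) := continuous_id.prodMk continuous_const
  refine ⟨fun w => Ψ (w, 0), ?_, ?_, ?_, ?_⟩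
  · show Ψ (D δ₀, 0) = δ₀
    rw [← hΦδ₀]; exact hΨ0
  · have h1 : ContDiffAt ℝ n Ψ (D δ₀, (0 : K →L[ℝ] ℝ)) := by rw [← hΦδ₀]; exact hΨcd
    exact h1.comp (D δ₀) (contDiffAt_id.prodMk contDiffAt_const)
  · have ht : Tendsto (fun w : F => ((w, (0 : K →L[ℝ] ℝ)) : F × (K →L[ℝ] ℝ))) (𝓝 (D δ₀)) (𝓝 (Φ δ₀)) := by
      rw [hΦδ₀]; exact hj.continuousAt
    filter_upwards [ht.eventually hright] with w hw
    have h1 : D (Ψ (w, 0)) = w := congrArg Prod.fst hw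
    have h2 : R (fderiv ℝ V (Ψ (w, 0))) = 0 := congrArg Prod.snd hw
    exact ⟨h1, hR0' _ h2⟩
  · filter_upwards [hleft] with δ hδ hc
    have : Φ δ = (D δ, 0) := by simp only [hΦ, hR0 δ hc]
    rw [← this]; exact hδ

/-- The POSITIVE-DEFINITE case (the road's: `D²V(δ₀)[k,k] > 0` on `ker D ∖ {0}` is non-degeneracy). [folklore] -/
theorem exists_contDiffAt_criticalBranch_of_pos {V : E → ℝ} {D : E →L[ℝ] F} (hD : Surjective D) {δ₀ : E} {n : ℕ}
    (hn : 1 ≤ n) (hV : ContDiffAt ℝ (n + 1) V δ₀) (hcrit : ∀ k ∈ D.ker, fderiv ℝ V δ₀ k = 0)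
    (hpos : ∀ k ∈ D.ker, k ≠ 0 → 0 < fderiv ℝ (fderiv ℝ V) δ₀ k k) :
    ∃ σ : F → E, σ (D δ₀) = δ₀ ∧ ContDiffAt ℝ n σ (D δ₀) ∧
      (∀ᶠ w in 𝓝 (D δ₀), D (σ w) = w ∧ ∀ k ∈ D.ker, fderiv ℝ V (σ w) k = 0) ∧
      (∀ᶠ δ in 𝓝 δ₀, (∀ k ∈ D.ker, fderiv ℝ V δ k = 0) → σ (D δ) = δ) :=
  exists_contDiffAt_criticalBranch hD hn hV hcrit fun k hk hk0 => by
    by_contra hne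
    exact (hpos k hk hne).ne' (hk0 k hk)

end Branch

/-! ## §2. Convexity: the branch is the fibre-minimiser map -/

/-- The differential of a convex function supports it (`E` merely normed; the tree's
`ConvexOn.apply_add_fderiv_le` is the inner-product-space statement, same proof). [folklore] -/
theorem convex_support_of_hasFDerivAt {V : E → ℝ} (hVc : ConvexOn ℝ univ V) {x y : E} {V' : E →L[ℝ] ℝ}
    (hd : HasFDerivAt V V' x) : V x + V' (y - x) ≤ V y := by
  set g : ℝ → ℝ := fun t => V (x + t • (y - x)) with hg
  have hgd : HasDerivAt g (V' (y - x)) 0 := by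
    have hline : HasDerivAt (fun t : ℝ => x + t • (y - x)) (y - x) 0 := by
      simpa using ((hasDerivAt_id (0 : ℝ)).smul_const (y - x)).const_add x
    have hd' : HasFDerivAt V V' (x + (0 : ℝ) • (y - x)) := by simpa using hd
    exact hd'.comp_hasDerivAt 0 hline
  have hslope : ∀ t ∈ Ioo (0 : ℝ) 1, t⁻¹ • (g (0 + t) - g 0) ≤ V y - V x := by
    intro t ht
    have hconv := hVc.2 (mem_univ x) (mem_univ y) (by linarith [ht.2] : 0 ≤ 1 - t) ht.1.le (by ring)
    have hpt : (1 - t) • x + t • y = x + t • (y - x) := by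
      simp only [sub_smul, one_smul, smul_sub]; abel
    rw [hpt] at hconv
    have hg0 : g 0 = V x := by simp [hg]
    have hgt : g (0 + t) = V (x + t • (y - x)) := by simp [hg]
    rw [hg0, hgt, smul_eq_mul, ← div_eq_inv_mul, div_le_iff₀ ht.1]
    simp only [smul_eq_mul] at hconv
    nlinarith [hconv, ht.1]
  have htend : Tendsto (fun t => t⁻¹ • (g (0 + t) - g 0)) (𝓝[>] 0) (𝓝 (V' (y - x))) :=
    hgd.tendsto_slope_zero_right
  have hle : V' (y - x) ≤ V y - V x :=
    le_of_tendsto htend (by filter_upwards [Ioo_mem_nhdsGT zero_lt_one] with t ht using hslope t ht)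
  linarith

/-- **CONVEX + FIBRE-CRITICAL ⟹ FIBRE-MINIMAL**: if `V` is convex and differentiable at `δ` and `DV(δ)` kills `ker D`,
then `δ` minimises `V` on its fibre `{δ' : D δ' = D δ}`. [folklore] -/
theorem isMinOn_fibre_of_critical {V : E → ℝ} (hVc : ConvexOn ℝ univ V) (D : E →L[ℝ] F) {δ : E}
    (hd : DifferentiableAt ℝ V δ) (hcrit : ∀ k ∈ D.ker, fderiv ℝ V δ k = 0) :
    IsMinOn V {δ' | D δ' = D δ} δ := by
  intro δ' hδ'
  have hk : δ' - δ ∈ D.ker := by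
    rw [LinearMap.mem_ker, ContinuousLinearMap.coe_coe, map_sub, sub_eq_zero]; exact hδ'
  have h := convex_support_of_hasFDerivAt hVc (y := δ') hd.hasFDerivAt
  rw [hcrit _ hk, add_zero] at h
  exact h

/-- For STRICTLY convex `V` the fibre minimiser is unique. [folklore] -/
theorem eq_of_isMinOn_fibre {V : E → ℝ} (hVc : StrictConvexOn ℝ univ V) (D : E →L[ℝ] F) (w : F) {δ₁ δ₂ : E}
    (h₁ : IsMinOn V {δ | D δ = w} δ₁) (h₂ : IsMinOn V {δ | D δ = w} δ₂) (hδ₁ : D δ₁ = w) (hδ₂ : D δ₂ = w) :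
    δ₁ = δ₂ := by
  have hconv : Convex ℝ {δ : E | D δ = w} := by
    intro x hx y hy a b _ _ hab
    simp only [mem_setOf_eq, map_add, map_smul] at hx hy ⊢
    rw [hx, hy, ← add_smul, hab, one_smul]
  exact (hVc.subset (subset_univ _) hconv).eq_of_isMinOn h₁ h₂ hδ₁ hδ₂

/-- **THE BRANCH IS THE MINIMISER MAP** (convex case): wherever `D(σ w) = w` and `σ w` is fibre-critical and `V` is
differentiable there, `σ w` minimises `V` on the fibre over `w`. [folklore] -/
theorem criticalBranch_isMinOn {V : E → ℝ} (hVc : ConvexOn ℝ univ V) (D : E →L[ℝ] F) {σ : F → E} {w : F}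
    (hDσ : D (σ w) = w) (hd : DifferentiableAt ℝ V (σ w)) (hcrit : ∀ k ∈ D.ker, fderiv ℝ V (σ w) k = 0) :
    IsMinOn V {δ | D δ = w} (σ w) := by
  have h := isMinOn_fibre_of_critical hVc D hd hcrit
  rwa [hDσ] at h

/-! ## §3. The value function is `C^{n+1}`: the envelope formula off the base point and one more derivative -/

/-- **THE ENVELOPE FORMULA ALONG THE BRANCH**: if `D (σ w′) = w′` for `w′` near `w`, `σ` is differentiable at `w`, `V` is
differentiable at `σ w` and `DV(σ w)` kills `ker D`, then `D(V ∘ σ)(w) = DV(σ w) ∘ M` for ANY right inverse `M` of `D`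
(the directions `Dσ(w)h − Mh` lie in `ker D`). [folklore] -/
theorem hasFDerivAt_comp_branch {V : E → ℝ} {D : E →L[ℝ] F} {M : F →L[ℝ] E} (hM : ∀ w, D (M w) = w) {σ : F → E}
    {w : F} (hDσ : ∀ᶠ w' in 𝓝 w, D (σ w') = w') (hσ : DifferentiableAt ℝ σ w) (hd : DifferentiableAt ℝ V (σ w))
    (hcrit : ∀ k ∈ D.ker, fderiv ℝ V (σ w) k = 0) :
    HasFDerivAt (V ∘ σ) ((fderiv ℝ V (σ w)).comp M) w := by
  have hchain : HasFDerivAt (V ∘ σ) ((fderiv ℝ V (σ w)).comp (fderiv ℝ σ w)) w :=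
    hd.hasFDerivAt.comp w hσ.hasFDerivAt
  -- `D ∘ Dσ(w) = id`
  have hDs : HasFDerivAt (fun w' => D (σ w')) (D.comp (fderiv ℝ σ w)) w := D.hasFDerivAt.comp w hσ.hasFDerivAt
  have hid : HasFDerivAt (fun w' => D (σ w')) (ContinuousLinearMap.id ℝ F) w :=
    (hasFDerivAt_id w).congr_of_eventuallyEq (hDσ.mono fun w' hw' => by simp [hw'])
  have hDσ' : D.comp (fderiv ℝ σ w) = ContinuousLinearMap.id ℝ F := hDs.unique hid
  have heq : (fderiv ℝ V (σ w)).comp (fderiv ℝ σ w) = (fderiv ℝ V (σ w)).comp M := by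
    ext h
    have hk : fderiv ℝ σ w h - M h ∈ D.ker := by
      rw [LinearMap.mem_ker, ContinuousLinearMap.coe_coe, map_sub, hM, sub_eq_zero]
      exact congrArg (fun L : F →L[ℝ] F => L h) hDσ'
    have h0 := hcrit _ hk
    rw [map_sub, sub_eq_zero] at h0
    simpa using h0
  rw [← heq]; exact hchain

/-- Where the branch minimises and the fibre is its own: `⨅ δ : {δ // D δ = w}, V δ = V (σ w)`. [folklore] -/
theorem iInf_fibre_eq_of_isMinOn {V : E → ℝ} (D : E →L[ℝ] F) {σ : F → E} {w : F} (hDσ : D (σ w) = w)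
    (hmin : IsMinOn V {δ | D δ = w} (σ w)) : (⨅ δ : {δ // D δ = w}, V δ.1) = V (σ w) := by
  haveI : Nonempty {δ // D δ = w} := ⟨⟨σ w, hDσ⟩⟩
  have hle : ∀ δ : {δ // D δ = w}, V (σ w) ≤ V δ.1 := fun δ => hmin δ.2
  have hbdd : BddBelow (range fun δ : {δ // D δ = w} => V δ.1) := ⟨V (σ w), by rintro _ ⟨δ, rfl⟩; exact hle δ⟩
  exact le_antisymm (ciInf_le hbdd ⟨σ w, hDσ⟩) (le_ciInf hle)

/-- **THE ENVELOPE DERIVATIVE OF THE VALUE FUNCTION NEAR `w₀`**: with a branch `σ` as in §1 on a neighbourhood where `V` is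
convex-minimised, `HasFDerivAt φ (DV(σ w) ∘ M) w` for every `w` near `w₀`, `φ w = ⨅ δ : {δ // D δ = w}, V δ`. [folklore] -/
theorem hasFDerivAt_constrValue_branch {V : E → ℝ} (hVc : ConvexOn ℝ univ V) {D : E →L[ℝ] F} {M : F →L[ℝ] E}
    (hM : ∀ w, D (M w) = w) {σ : F → E} {w₀ : F}
    (hbr : ∀ᶠ w in 𝓝 w₀, D (σ w) = w ∧ ∀ k ∈ D.ker, fderiv ℝ V (σ w) k = 0)
    (hσd : ∀ᶠ w in 𝓝 w₀, DifferentiableAt ℝ σ w) (hVd : ∀ᶠ w in 𝓝 w₀, DifferentiableAt ℝ V (σ w)) :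
    ∀ᶠ w in 𝓝 w₀, HasFDerivAt (fun w => ⨅ δ : {δ // D δ = w}, V δ.1) ((fderiv ℝ V (σ w)).comp M) w := by
  have hev : ∀ᶠ w in 𝓝 w₀, (⨅ δ : {δ // D δ = w}, V δ.1) = V (σ w) := by
    filter_upwards [hbr, hVd] with w hw hVw
    exact iInf_fibre_eq_of_isMinOn D hw.1 (criticalBranch_isMinOn hVc D hw.1 hVw hw.2)
  filter_upwards [eventually_eventually_nhds.mpr hbr, eventually_eventually_nhds.mpr hev, hbr, hσd, hVd]
    with w hbrw hevw hw hσw hVw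
  have h := hasFDerivAt_comp_branch hM (hbrw.mono fun w' hw' => hw'.1) hσw hVw hw.2
  exact h.congr_of_eventuallyEq (hevw.mono fun w' hw' => by simpa [Function.comp] using hw')

/-- **THE HARD-CONSTRAINT VALUE FUNCTION IS `C^{n+1}` AT A NON-DEGENERATE MINIMISER** (finite dimension; `V` convex on `E`,
of class `C^{n+1}` at `δ₀` with `1 ≤ n`; `D` onto; `δ₀` a fibre minimiser over `w₀ = Dδ₀` — criticality follows — with
`D²V(δ₀)` positive on `ker D ∖ {0}`): `φ = (w ↦ ⨅ δ : {δ // D δ = w}, V δ)` is `C^{n+1}` at `w₀` — the minimiser branch is `Cⁿ`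
(§1), it computes `φ` near `w₀` (§2), and `Dφ = (DV ∘ σ) ∘ M` is `Cⁿ` (§3): ONE ORDER MORE than the branch. [folklore] -/
theorem contDiffAt_constrValue [FiniteDimensional ℝ E] [FiniteDimensional ℝ F] {V : E → ℝ} (hVc : ConvexOn ℝ univ V)
    {D : E →L[ℝ] F} (hD : Surjective D) {δ₀ : E} {n : ℕ} (hn : 1 ≤ n) (hV : ContDiffAt ℝ (n + 1) V δ₀)
    (hmin : IsMinOn V {δ | D δ = D δ₀} δ₀) (hpos : ∀ k ∈ D.ker, k ≠ 0 → 0 < fderiv ℝ (fderiv ℝ V) δ₀ k k) :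
    ContDiffAt ℝ (n + 1) (fun w => ⨅ δ : {δ // D δ = w}, V δ.1) (D δ₀) := by
  haveI : CompleteSpace E := FiniteDimensional.complete ℝ E
  -- a right inverse of `D`
  obtain ⟨Mₗ, hMₗ⟩ := (D : E →ₗ[ℝ] F).exists_rightInverse_of_surjective (LinearMap.range_eq_top.mpr hD)
  set M : F →L[ℝ] E := LinearMap.toContinuousLinearMap Mₗ with hMdef
  have hM : ∀ w, D (M w) = w := fun w => by
    have h := congrArg (fun L : F →ₗ[ℝ] F => L w) hMₗ
    simpa [hMdef] using h
  -- Fermat on the fibre: criticality of the minimiser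
  have hn1 : ((n : WithTop ℕ∞) + 1) ≠ 0 := by exact_mod_cast Nat.succ_ne_zero n
  have hn1' : ((n : WithTop ℕ∞) + 1) ≠ ((⊤ : ℕ∞) : WithTop ℕ∞) := by exact_mod_cast ENat.coe_ne_top (n + 1)
  have hn' : (n : WithTop ℕ∞) ≠ ((⊤ : ℕ∞) : WithTop ℕ∞) := by exact_mod_cast ENat.coe_ne_top n
  have hVd₀ : DifferentiableAt ℝ V δ₀ := hV.differentiableAt hn1
  have hcrit : ∀ k ∈ D.ker, fderiv ℝ V δ₀ k = 0 := by
    intro k hk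
    have hline : ∀ t : ℝ, δ₀ + t • k ∈ {δ | D δ = D δ₀} := fun t => by
      simp only [mem_setOf_eq, map_add, map_smul, show D k = 0 from hk, smul_zero, add_zero]
    have hg : HasDerivAt (fun t : ℝ => V (δ₀ + t • k)) (fderiv ℝ V δ₀ k) 0 := by
      have hl : HasDerivAt (fun t : ℝ => δ₀ + t • k) k 0 := by
        simpa using ((hasDerivAt_id (0 : ℝ)).smul_const k).const_add δ₀
      have hd' : HasFDerivAt V (fderiv ℝ V δ₀) (δ₀ + (0 : ℝ) • k) := by simpa using hVd₀.hasFDerivAt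
      exact hd'.comp_hasDerivAt 0 hl
    have hlocal : IsLocalMin (fun t : ℝ => V (δ₀ + t • k)) 0 :=
      Filter.Eventually.of_forall fun t => by simpa using hmin (hline t)
    exact IsLocalMin.hasDerivAt_eq_zero hlocal hg
  -- the branch
  obtain ⟨σ, hσ0, hσcd, hbr, -⟩ := exists_contDiffAt_criticalBranch_of_pos hD hn hV hcrit hpos
  -- `σ` and `V ∘ σ` differentiable near `w₀`; `DV ∘ σ` of class `Cⁿ`
  have hn0 : (n : WithTop ℕ∞) ≠ 0 := by exact_mod_cast (Nat.one_le_iff_ne_zero.mp hn)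
  have hσd : ∀ᶠ w in 𝓝 (D δ₀), DifferentiableAt ℝ σ w :=
    (hσcd.eventually hn').mono fun w hw => hw.differentiableAt hn0
  have hdV : ContDiffAt ℝ n (fderiv ℝ V) δ₀ := hV.fderiv_right (by norm_cast)
  have hVd : ∀ᶠ w in 𝓝 (D δ₀), DifferentiableAt ℝ V (σ w) := by
    have h1 : ∀ᶠ δ in 𝓝 δ₀, DifferentiableAt ℝ V δ :=
      (hV.eventually hn1').mono fun δ hδ => hδ.differentiableAt hn1
    have hσc : ContinuousAt σ (D δ₀) := hσcd.continuousAt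
    rw [← hσ0] at h1
    exact hσc.eventually h1
  have hderiv := hasFDerivAt_constrValue_branch hVc hM hbr hσd hVd
  -- one more derivative
  rw [show ((n : WithTop ℕ∞) + 1) = ((n + 1 : ℕ) : WithTop ℕ∞) by norm_cast] at *
  rw [show ((n + 1 : ℕ) : WithTop ℕ∞) = (n : WithTop ℕ∞) + 1 by norm_cast, contDiffAt_succ_iff_hasFDerivAt]
  refine ⟨fun w => (fderiv ℝ V (σ w)).comp M, ?_, ?_⟩
  · obtain ⟨u, hu, hu'⟩ := eventually_iff_exists_mem.mp hderiv
    exact ⟨u, hu, hu'⟩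
  · have hg : ContDiffAt ℝ n (fun w => fderiv ℝ V (σ w)) (D δ₀) := by
      have h1 : ContDiffAt ℝ n (fderiv ℝ V) (σ (D δ₀)) := by rw [hσ0]; exact hdV
      exact h1.comp (D δ₀) hσcd
    exact ((ContinuousLinearMap.compL ℝ F E ℝ).flip M).contDiff.contDiffAt.comp (D δ₀) hg

/-! ## §4. Toy -/

/-- Toy: `E = F = ℝ`, `D = id` (onto, `ker D = 0` so every point is fibre-critical and non-degenerate vacuously): the
fibre over `w` is `{w}` and the value function is `V` itself — the theorem returns `V`'s own class `C^{n+1}`.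
[folklore] -/
example {V : ℝ → ℝ} (hVc : ConvexOn ℝ univ V) {x : ℝ} {n : ℕ} (hn : 1 ≤ n) (hV : ContDiffAt ℝ (n + 1) V x) :
    ContDiffAt ℝ (n + 1) (fun w => ⨅ δ : {δ // (ContinuousLinearMap.id ℝ ℝ) δ = w}, V δ.1)
      ((ContinuousLinearMap.id ℝ ℝ) x) := by
  refine contDiffAt_constrValue hVc (fun w => ⟨w, rfl⟩) hn hV ?_ ?_
  · intro δ hδ
    simp only [ContinuousLinearMap.coe_id', id_eq, mem_setOf_eq] at hδ
    simp [hδ]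
  · intro k hk hk0
    exact absurd (by simpa using hk) hk0

end Summit.QuantumFields.BalabanUV.T4Continuum.NE7b.ConstrainedMinimiserRegular

end
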